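import Mathlib.Analysis.Fourier.FourierTransform
import Mathlib.Analysis.Calculus.FDeriv.Equiv
import Literature.Analysis.FluidPDE.TaoAveragedEuler
import HarnessLib

/-!
# Route OddMorawetz — `MorawetzKillsTypeI`, reflection covariance of the Euler bilinear operator
(item stmt-NavierStokesRegularity-1377, stub `stub_reflect_eulerBilinear`)

The spatial reflection `P v (x) := −v(−x)` used to kill even derivative weights in the
Morawetz-certificate argument commutes with Tao's exact Euler bilinear operator
`B(u,v) = −½ P_L[(u·∇)v + (v·∇)u]` (`Literature.Analysis.FluidPDE.eulerBilinear`, Tao 2016, (1.8),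
`P_L` the function-level Leray projector `lerayProjFun`):
`B(Pv, Pv) = P (B(v, v))` for EVERY field `v : ℝ³ → ℝ³`.

No regularity or integrability is assumed: every step is a symmetry of (Bochner) integrals or of
`fderiv`, valid with their junk conventions.
* `convect (Pv) (Pv) x = −(convect v v) (−x)`: `fderiv ℝ (Pv) x = fderiv ℝ v (−x)` by
  `fderiv_fun_neg` and `ContinuousLinearEquiv.comp_right_fderiv` (both unconditional);
* `fourierVec (P g) ξ = −(fourierVec g) (−ξ)`: `𝓕 (−f) = −𝓕 f` (`integral_neg`) and
  `𝓕 (f ∘ neg) = 𝓕 f ∘ neg` (`Real.fourier_comp_linearIsometry` with `LinearIsometryEquiv.neg`);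
* the complexified Leray symbol `leraySymbolC ξ c` is even in `ξ` and odd in `c`;
* `𝓕⁻ (ξ ↦ −F(−ξ)) x = −(𝓕⁻ F) (−x)` likewise, and `realPart (−w) = −realPart w`.
-/

noncomputable section

set_option linter.dupNamespace false

open MeasureTheory FourierTransform
open scoped RealInnerProductSpace

namespace Summit.NavierStokesRegularity.NavierStokesRegularity.Theorems

open Literature.Analysis.FluidPDE Literature.Analysis.FunctionSpaces

namespace ReflectEulerBilinear

section Reflect

variable {E F : Type*} [NormedAddCommGroup E] [NormedSpace ℝ E] [NormedAddCommGroup F]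
  [NormedSpace ℝ F]

/-- **Chain rule for the reflection, unconditionally**: `D(x ↦ −v(−x))(x) w = Dv(−x) w` for every
`v`, `x`, `w` (off the differentiability locus both sides are the junk `0`, consistently:
`fderiv_fun_neg` and `ContinuousLinearEquiv.comp_right_fderiv` need no hypotheses). -/
theorem fderiv_reflect_apply (v : E → F) (x w : E) :
    fderiv ℝ (fun x => -v (-x)) x w = fderiv ℝ v (-x) w := by
  have hfun : (fun x => -v (-x)) =
      fun x => -((v ∘ ⇑(ContinuousLinearEquiv.neg ℝ : E ≃L[ℝ] E)) x) := by
    funext y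
    simp only [Function.comp_apply, ContinuousLinearEquiv.neg_apply]
  rw [hfun, fderiv_fun_neg, ContinuousLinearEquiv.comp_right_fderiv]
  simp only [neg_apply, ContinuousLinearMap.comp_apply, ContinuousLinearEquiv.coe_coe,
    ContinuousLinearEquiv.neg_apply, map_neg, neg_neg]

end Reflect

section Convect

variable {E : Type*} [NormedAddCommGroup E] [InnerProductSpace ℝ E]

/-- **The convective derivative of the reflected field**: `((Pv·∇)Pv)(x) = −((v·∇)v)(−x)` for
`P v (x) = −v(−x)`, for every field `v` (no differentiability needed). -/
theorem convect_reflect (v : E → E) (x : E) :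
    convect (fun x => -v (-x)) (fun x => -v (-x)) x = -(convect v v (-x)) := by
  simp only [convect]
  rw [fderiv_reflect_apply, map_neg]

end Convect

section Fourier

variable {V W : Type*} [NormedAddCommGroup V] [InnerProductSpace ℝ V] [MeasurableSpace V]
  [BorelSpace V] [FiniteDimensional ℝ V] [NormedAddCommGroup W] [NormedSpace ℂ W]

/-- `𝓕 (x ↦ −f(−x)) ξ = −(𝓕 f)(−ξ)` for every `f` (Bochner conventions included: `integral_neg`
and the change of variables `x ↦ −x`, `Real.fourier_comp_linearIsometry`, are unconditional). -/
theorem fourier_reflect_apply (f : V → W) (ξ : V) :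
    𝓕 (fun x => -f (-x)) ξ = -(𝓕 f (-ξ)) := by
  have h := Real.fourier_comp_linearIsometry (LinearIsometryEquiv.neg ℝ (E := V)) f ξ
  simp only [LinearIsometryEquiv.coe_neg] at h
  rw [← h]
  simp only [Real.fourier_eq, Function.comp_apply, smul_neg, integral_neg]

/-- `𝓕⁻ (ξ ↦ −F(−ξ)) x = −(𝓕⁻ F)(−x)` for every `F` (unconditional, as above with
`Real.fourierInv_comp_linearIsometry`). -/
theorem fourierInv_reflect_apply (F : V → W) (x : V) :
    𝓕⁻ (fun ξ => -F (-ξ)) x = -(𝓕⁻ F (-x)) := by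
  have h := Real.fourierInv_comp_linearIsometry (LinearIsometryEquiv.neg ℝ (E := V)) F x
  simp only [LinearIsometryEquiv.coe_neg] at h
  rw [← h]
  simp only [Real.fourierInv_eq, Function.comp_apply, smul_neg, integral_neg]

end Fourier

section Leray

variable {ι : Type*}

/-- The real part is odd: `realPart (−w) = −realPart w`. -/
theorem realPart_neg (w : EuclideanSpace ℂ ι) : realPart (-w) = -realPart w := by
  ext i
  simp only [realPart_apply, PiLp.neg_apply, Complex.neg_re]

variable [Fintype ι]

/-- **The complexified Leray symbol is even in the frequency**: `P̂(−ξ) c = P̂(ξ) c`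
(`ξ ⊗ ξ / |ξ|²` is even). -/
theorem leraySymbolC_neg_left (ξ : EuclideanSpace ℝ ι) (c : EuclideanSpace ℂ ι) :
    leraySymbolC (-ξ) c = leraySymbolC ξ c := by
  unfold leraySymbolC
  simp only [PiLp.neg_apply, Complex.ofReal_neg, neg_mul, Finset.sum_neg_distrib, norm_neg,
    map_neg, smul_neg, neg_div, neg_smul, neg_neg]

/-- **The complexified Leray symbol is odd (indeed linear) in the vector slot**:
`P̂(ξ) (−c) = −P̂(ξ) c`. -/
theorem leraySymbolC_neg_right (ξ : EuclideanSpace ℝ ι) (c : EuclideanSpace ℂ ι) :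
    leraySymbolC ξ (-c) = -leraySymbolC ξ c := by
  unfold leraySymbolC
  simp only [PiLp.neg_apply, mul_neg, Finset.sum_neg_distrib, neg_div, neg_smul, neg_sub',
    sub_neg_eq_add]

/-- **The Fourier transform of the reflected field**: `(P g)^(ξ) = −ĝ(−ξ)` for every real field
`g` (`complexify` is `ℝ`-linear, then `fourier_reflect_apply`). -/
theorem fourierVec_reflect_apply (g : EuclideanSpace ℝ ι → EuclideanSpace ℝ ι)
    (ξ : EuclideanSpace ℝ ι) :
    fourierVec (fun x => -g (-x)) ξ = -(fourierVec g (-ξ)) := by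
  unfold fourierVec
  have hc : (EuclideanSpace.complexify ∘ fun x => -g (-x)) =
      fun x => -((EuclideanSpace.complexify ∘ g) (-x)) := by
    funext y
    simp only [Function.comp_apply, map_neg]
  rw [hc, fourier_reflect_apply]

/-- **Reflection covariance of the function-level Leray projector**: `P_L (P g) = P (P_L g)` for
every real field `g`, i.e. `lerayProjFun (x ↦ −g(−x)) = x ↦ −(lerayProjFun g)(−x)`
(unconditional). -/
theorem lerayProjFun_reflect (g : EuclideanSpace ℝ ι → EuclideanSpace ℝ ι) :
    lerayProjFun (fun x => -g (-x)) = fun x => -(lerayProjFun g (-x)) := by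
  funext x
  unfold lerayProjFun
  have hG : (fun ξ => leraySymbolC ξ (fourierVec (fun x => -g (-x)) ξ)) =
      fun ξ => -((fun η => leraySymbolC η (fourierVec g η)) (-ξ)) := by
    funext ξ
    change _ = -(leraySymbolC (-ξ) (fourierVec g (-ξ)))
    rw [fourierVec_reflect_apply, leraySymbolC_neg_right, leraySymbolC_neg_left]
  rw [hG, fourierInv_reflect_apply (fun η => leraySymbolC η (fourierVec g η)) x, realPart_neg]

end Leray

end ReflectEulerBilinear

open ReflectEulerBilinear in
/-- **Reflection covariance of the Euler bilinear operator** (item stmt-NavierStokesRegularity-1377,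
route OddMorawetz, stub `stub_reflect_eulerBilinear`): for `P v (x) = −v(−x)` and Tao's exact
Leray-projected nonlinearity `B = eulerBilinear` (Tao 2016, (1.8)), `B(Pv, Pv) = P (B(v, v))` for
EVERY `v : ℝ³ → ℝ³` — no regularity is assumed, the identity holds through the Bochner/`fderiv`
junk conventions since every step is a symmetry (`convect_reflect`, `lerayProjFun_reflect`). -/
theorem stub_reflect_eulerBilinear :
    ∀ v : EuclideanSpace ℝ (Fin 3) → EuclideanSpace ℝ (Fin 3),
      Literature.Analysis.FluidPDE.eulerBilinear (fun x => -v (-x)) (fun x => -v (-x)) =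
        fun x => -(Literature.Analysis.FluidPDE.eulerBilinear v v (-x)) := by
  intro v
  unfold eulerBilinear
  have hg : (fun x => convect (fun x => -v (-x)) (fun x => -v (-x)) x +
        convect (fun x => -v (-x)) (fun x => -v (-x)) x) =
      fun x => -((fun y => convect v v y + convect v v y) (-x)) := by
    funext x
    rw [convect_reflect, ← neg_add]
  rw [hg, lerayProjFun_reflect (fun y => convect v v y + convect v v y)]
  funext x
  simp only [Pi.smul_apply, smul_neg]

end Summit.NavierStokesRegularity.NavierStokesRegularity.Theorems
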